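import Summits.QuantumFields.YangMills.Theorems.TwistExponentGapTwistedPlaquetteCost
import Summits.QuantumFields.YangMills.Theorems.TwistExponentGapHodgeConstant
import HarnessLib

/-!
# Hodge data of the twisted-flat gauge complex, in matrix form (step (W3c) of ⟨stmt-QuantumFields-24054⟩)
# (route-independent helper toward the crux `TwistExponentGap.RigidTwistCeiling`; free hands of width seat ym-line-sfw-p2-w3)

At a `z`-twisted-flat configuration `U₀` (pair-rigid central twist `z`) the `ℓ²` cochain complex
`C⁰(sites; 𝔤_r) —d₀→ C¹(links; 𝔤_r) —d₁→ C²(plaquettes; 𝔤_r)`, `(d₀η)_e = η_x − Ad_{U₀ e} η_y`,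
`(d₁X)_p = X₁ + Ad X₂ − Ad X₃ − X₄`, satisfies `d₁ ∘ d₀ = 0` (Ad-flatness) and `ker d₁ = range d₀`
(`twistedFlat_cocycle_exact`, p776008), so `exists_hodge_constant` (p776200) applies.  `exists_hodge_data` exports the
result at the MATRIX level (no bundled maps in the statement): a constant `K > 0` such that every `𝔤_r`-valued link field `X`
splits as `X = d₀η + rest` with `Σ‖X_e‖² = T² + B²`, `Σ Re tr(X_e† (d₀η)_e) = T²`, `‖(d₀η)_e‖ ≤ T` and `B² ≤ K² Σ_p ‖(d₁X)_p‖²`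
(`T = ‖d₀η‖`, `B = ‖rest‖`).  Consumed by `quadraticGrowth_of_gaugeMinimal` (LocalMorseBottCore).
HONEST FRAMING: finite-dimensional linear algebra on a fixed lattice; nothing here bears on a summit statement or on the mass gap.
-/

set_option autoImplicit false

noncomputable section

open scoped Matrix Matrix.Norms.Frobenius RealInnerProductSpace BigOperators
open NormedSpace
open Literature.MathematicalPhysics.QuantumFieldTheory
open Literature.MathematicalPhysics.QuantumLattice

namespace Summit.QuantumFields.YangMills.Theorems.TwistExponentGap

variable {G : Type*} [Group G] [TopologicalSpace G] [IsTopologicalGroup G] [CompactSpace G]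

omit [IsTopologicalGroup G] in
/-- **Hodge data of the twisted-flat complex (matrix form).**  At a `z`-twisted-flat `U₀` with pair-rigid central `z` there is
`K > 0` such that every link field `X` with values in `𝔤_r = repLieAlgebra r` admits a site field `η` (values in `𝔤_r`) and reals
`T, B ≥ 0` with `Σ_e ‖X_e‖² = T² + B²`, `Σ_e Re tr(X_e† (η_x − Ad_{U₀e} η_y)) = T²`, `‖η_x − Ad_{U₀e} η_y‖ ≤ T` for every link, and
`B² ≤ K² · Σ_p ‖X₁ + Ad X₂ − Ad X₃ − X₄‖²` (Frobenius norms). -/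
theorem exists_hodge_data (r : LatticeRep G) {d S : ℕ} [NeZero S] (U₀ : GaugeConfig d S G)
    (q : {p : Fin d × Fin d // p.1 < p.2}) (z : G) (hz : z ∈ Subgroup.center G)
    (hrig : ∀ x y : G, x * y * x⁻¹ * y⁻¹ = z → Set.Finite {k : G | k * x = x * k ∧ k * y = y * k})
    (htf : ∀ p : Plaquette d S, (if p.2 = q ∧ p.1 q.1.1 = 0 ∧ p.1 q.1.2 = 0 then z else 1) *
      plaquetteHolonomy U₀ p.1 p.2.1.1 p.2.1.2 = 1) :
    ∃ K : ℝ, 0 < K ∧ ∀ X : Edge d S → Matrix (Fin r.N) (Fin r.N) ℂ, (∀ e, X e ∈ repLieAlgebra r) →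
      ∃ (η : Site d S → Matrix (Fin r.N) (Fin r.N) ℂ) (T B : ℝ), (∀ x, η x ∈ repLieAlgebra r) ∧ 0 ≤ T ∧ 0 ≤ B ∧
        (∑ e, ‖X e‖ ^ 2 = T ^ 2 + B ^ 2) ∧
        (∑ e : Edge d S, (Matrix.trace ((X e)ᴴ * (η e.1 - r.ρ (U₀ e) * η (e.1.shift e.2) * r.ρ (U₀ e)⁻¹))).re = T ^ 2) ∧
        (∀ e : Edge d S, ‖η e.1 - r.ρ (U₀ e) * η (e.1.shift e.2) * r.ρ (U₀ e)⁻¹‖ ≤ T) ∧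
        B ^ 2 ≤ K ^ 2 * ∑ p : Plaquette d S,
          ‖X (p.1, p.2.1.1) + r.ρ (U₀ (p.1, p.2.1.1)) * X (p.1.shift p.2.1.1, p.2.1.2) * r.ρ (U₀ (p.1, p.2.1.1))⁻¹ -
            r.ρ (U₀ (p.1, p.2.1.2)) * X (p.1.shift p.2.1.2, p.2.1.1) * r.ρ (U₀ (p.1, p.2.1.2))⁻¹ - X (p.1, p.2.1.2)‖ ^ 2 := by
  classical
  letI : InnerProductSpace ℝ (Matrix (Fin r.N) (Fin r.N) ℂ) := frobeniusInnerProductSpace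
  -- the Lie algebra and `Ad`
  let W : Submodule ℝ (Matrix (Fin r.N) (Fin r.N) ℂ) := repLieAlgebra r
  haveI : FiniteDimensional ℝ W := inferInstance
  have hinv1 : ∀ g : G, r.ρ g⁻¹ * r.ρ g = 1 := fun g => by rw [← map_mul, inv_mul_cancel, map_one]
  have hinv2 : ∀ g : G, r.ρ g * r.ρ g⁻¹ = 1 := fun g => by rw [← map_mul, mul_inv_cancel, map_one]
  let AdL : G → (W →ₗ[ℝ] W) := fun g =>
    { toFun := fun w => ⟨r.ρ g * (w : Matrix (Fin r.N) (Fin r.N) ℂ) * r.ρ g⁻¹, conj_mem_repLieAlgebra r g w.2⟩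
      map_add' := fun a b => by ext1; simp only [Submodule.coe_add, Matrix.mul_add, Matrix.add_mul]
      map_smul' := fun t a => by
        ext1; simp only [Submodule.coe_smul, RingHom.id_apply, Matrix.mul_smul, Matrix.smul_mul] }
  have hAdL : ∀ (g : G) (w : W), ((AdL g w : W) : Matrix (Fin r.N) (Fin r.N) ℂ) = r.ρ g * w * r.ρ g⁻¹ := fun g w => rfl
  have hAdLinv : ∀ (g : G) (w : W), AdL g⁻¹ (AdL g w) = w := fun g w => by
    ext1
    rw [hAdL, hAdL, inv_inv]
    calc r.ρ g⁻¹ * (r.ρ g * (w : Matrix (Fin r.N) (Fin r.N) ℂ) * r.ρ g⁻¹) * r.ρ g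
        = (r.ρ g⁻¹ * r.ρ g) * (w : Matrix (Fin r.N) (Fin r.N) ℂ) * (r.ρ g⁻¹ * r.ρ g) := by noncomm_ring
      _ = w := by rw [hinv1, one_mul, mul_one]
  have hAdLinv' : ∀ (g : G) (w : W), AdL g (AdL g⁻¹ w) = w := fun g w => by
    have := hAdLinv g⁻¹ w
    rwa [inv_inv] at this
  have hAdLnorm : ∀ (g : G) (w : W), ‖AdL g w‖ = ‖w‖ := fun g w => by
    change ‖(r.ρ g * (w : Matrix (Fin r.N) (Fin r.N) ℂ) * r.ρ g⁻¹ : Matrix (Fin r.N) (Fin r.N) ℂ)‖ =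
      ‖(w : Matrix (Fin r.N) (Fin r.N) ℂ)‖
    exact norm_conj_eq r g _
  let Ad : G → (W ≃ₗᵢ[ℝ] W) := fun g =>
    { toLinearEquiv :=
        { toLinearMap := AdL g
          invFun := AdL g⁻¹
          left_inv := fun w => hAdLinv g w
          right_inv := fun w => hAdLinv' g w }
      norm_map' := fun w => hAdLnorm g w }
  have hAd : ∀ (g : G) (w : W), ((Ad g w : W) : Matrix (Fin r.N) (Fin r.N) ℂ) = r.ρ g * w * r.ρ g⁻¹ := fun g w => rfl
  have hAdmul : ∀ (a b : G) (w : W), Ad a (Ad b w) = Ad (a * b) w := fun a b w => by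
    ext1
    simp only [hAd, map_mul, mul_inv_rev]
    noncomm_ring
  have hAdcent : ∀ c : G, c ∈ Subgroup.center G → ∀ w : W, Ad c w = w := fun c hc w => by
    ext1
    rw [hAd, rho_center_mul_eq_mul r hc w.2, mul_assoc, hinv2, mul_one]
  -- twisted flatness in group form and Ad-flatness
  have hplane : ∀ (x : Site d S) (μ ν : Fin d), ∃ c : G, c ∈ Subgroup.center G ∧
      U₀ (x, μ) * U₀ (x.shift μ, ν) = c * (U₀ (x, ν) * U₀ (x.shift ν, μ)) := by
    intro x μ ν
    rcases lt_trichotomy μ ν with hlt | heq | hgt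
    · have h := htf (x, ⟨(μ, ν), hlt⟩)
      simp only at h
      set t : G := (if (⟨(μ, ν), hlt⟩ : {p : Fin d × Fin d // p.1 < p.2}) = q ∧ x q.1.1 = 0 ∧ x q.1.2 = 0 then z else 1)
        with ht
      have htc : t ∈ Subgroup.center G := by rw [ht]; split_ifs; exacts [hz, one_mem _]
      refine ⟨t⁻¹, inv_mem htc, ?_⟩
      have h1 : plaquetteHolonomy U₀ x μ ν = t⁻¹ := eq_inv_of_mul_eq_one_right h
      simp only [plaquetteHolonomy] at h1
      calc U₀ (x, μ) * U₀ (x.shift μ, ν)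
          = U₀ (x, μ) * U₀ (x.shift μ, ν) * (U₀ (x.shift ν, μ))⁻¹ * (U₀ (x, ν))⁻¹ * (U₀ (x, ν) * U₀ (x.shift ν, μ)) := by
            group
        _ = t⁻¹ * (U₀ (x, ν) * U₀ (x.shift ν, μ)) := by rw [h1]
    · subst heq; exact ⟨1, one_mem _, by rw [one_mul]⟩
    · have h := htf (x, ⟨(ν, μ), hgt⟩)
      simp only at h
      set t : G := (if (⟨(ν, μ), hgt⟩ : {p : Fin d × Fin d // p.1 < p.2}) = q ∧ x q.1.1 = 0 ∧ x q.1.2 = 0 then z else 1)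
        with ht
      have htc : t ∈ Subgroup.center G := by rw [ht]; split_ifs; exacts [hz, one_mem _]
      refine ⟨t, htc, ?_⟩
      have h1 : plaquetteHolonomy U₀ x ν μ = t⁻¹ := eq_inv_of_mul_eq_one_right h
      simp only [plaquetteHolonomy] at h1
      have h2 : U₀ (x, ν) * U₀ (x.shift ν, μ) = t⁻¹ * (U₀ (x, μ) * U₀ (x.shift μ, ν)) := by
        calc U₀ (x, ν) * U₀ (x.shift ν, μ)
            = U₀ (x, ν) * U₀ (x.shift ν, μ) * (U₀ (x.shift μ, ν))⁻¹ * (U₀ (x, μ))⁻¹ * (U₀ (x, μ) * U₀ (x.shift μ, ν)) := by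
              group
          _ = t⁻¹ * (U₀ (x, μ) * U₀ (x.shift μ, ν)) := by rw [h1]
      rw [h2, ← mul_assoc, mul_inv_cancel, one_mul]
  let A : Edge d S → (W ≃ₗᵢ[ℝ] W) := fun e => Ad (U₀ e)
  have hAapp : ∀ (e : Edge d S) (w : W), ((A e w : W) : Matrix (Fin r.N) (Fin r.N) ℂ) = r.ρ (U₀ e) * w * r.ρ (U₀ e)⁻¹ :=
    fun e w => rfl
  have hflat : ∀ (x : Site d S) (μ ν : Fin d) (w : W), A (x, μ) (A (x.shift μ, ν) w) = A (x, ν) (A (x.shift ν, μ) w) := by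
    intro x μ ν w
    obtain ⟨c, hc, hrel⟩ := hplane x μ ν
    show Ad (U₀ (x, μ)) (Ad (U₀ (x.shift μ, ν)) w) = Ad (U₀ (x, ν)) (Ad (U₀ (x.shift ν, μ)) w)
    rw [hAdmul, hAdmul, hrel, ← hAdmul c, hAdcent c hc]
  -- the complex `d₀ : C⁰ → C¹`, `d₁ : C¹ → C²`
  let d₀ : PiLp 2 (fun _ : Site d S => W) →ₗ[ℝ] PiLp 2 (fun _ : Edge d S => W) :=
    { toFun := fun η => WithLp.toLp 2 (fun e => η e.1 - A e (η (e.1.shift e.2)))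
      map_add' := fun a b => PiLp.ext fun e => by
        simp only [PiLp.add_apply, map_add]; abel
      map_smul' := fun t a => PiLp.ext fun e => by
        simp only [PiLp.smul_apply, map_smul, RingHom.id_apply, smul_sub] }
  have hd₀ : ∀ (η : PiLp 2 (fun _ : Site d S => W)) (e : Edge d S), d₀ η e = η e.1 - A e (η (e.1.shift e.2)) :=
    fun η e => rfl
  let d₁ : PiLp 2 (fun _ : Edge d S => W) →ₗ[ℝ] PiLp 2 (fun _ : Plaquette d S => W) :=
    { toFun := fun X => WithLp.toLp 2 (fun p =>
        X (p.1, p.2.1.1) + A (p.1, p.2.1.1) (X (p.1.shift p.2.1.1, p.2.1.2)) -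
          A (p.1, p.2.1.2) (X (p.1.shift p.2.1.2, p.2.1.1)) - X (p.1, p.2.1.2))
      map_add' := fun a b => PiLp.ext fun p => by
        simp only [PiLp.add_apply, map_add]; abel
      map_smul' := fun t a => PiLp.ext fun p => by
        simp only [PiLp.smul_apply, map_smul, RingHom.id_apply, smul_sub, smul_add] }
  have hd₁ : ∀ (X : PiLp 2 (fun _ : Edge d S => W)) (p : Plaquette d S), d₁ X p =
      X (p.1, p.2.1.1) + A (p.1, p.2.1.1) (X (p.1.shift p.2.1.1, p.2.1.2)) -
        A (p.1, p.2.1.2) (X (p.1.shift p.2.1.2, p.2.1.1)) - X (p.1, p.2.1.2) := fun X p => rfl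
  have hdd : ∀ η, d₁ (d₀ η) = 0 := by
    intro η
    refine PiLp.ext fun p => ?_
    rw [hd₁]
    simp only [hd₀, map_sub, PiLp.zero_apply]
    rw [hflat p.1 p.2.1.1 p.2.1.2, site_shift_shift_comm p.1 p.2.1.1 p.2.1.2]
    abel
  have hexact : ∀ X, d₁ X = 0 → X ∈ LinearMap.range d₀ := by
    intro X hX0
    have hD : ∀ p : Plaquette d S, X (p.1, p.2.1.1) + A (p.1, p.2.1.1) (X (p.1.shift p.2.1.1, p.2.1.2)) -
        A (p.1, p.2.1.2) (X (p.1.shift p.2.1.2, p.2.1.1)) - X (p.1, p.2.1.2) = 0 := fun p => by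
      have := congrArg (fun Y : PiLp 2 (fun _ : Plaquette d S => W) => Y p) hX0
      simpa only [hd₁, PiLp.zero_apply] using this
    -- matrix form of the cocycle, all ordered pairs
    have hF : ∀ (x : Site d S) (μ ν : Fin d), μ < ν →
        r.ρ (U₀ (x, μ)) * ((X (x.shift μ, ν) : W) : Matrix (Fin r.N) (Fin r.N) ℂ) * r.ρ (U₀ (x, μ))⁻¹ -
            ((X (x, ν) : W) : Matrix (Fin r.N) (Fin r.N) ℂ) =
          r.ρ (U₀ (x, ν)) * ((X (x.shift ν, μ) : W) : Matrix (Fin r.N) (Fin r.N) ℂ) * r.ρ (U₀ (x, ν))⁻¹ -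
            ((X (x, μ) : W) : Matrix (Fin r.N) (Fin r.N) ℂ) := by
      intro x μ ν hlt
      have h := congrArg (fun w : W => (w : Matrix (Fin r.N) (Fin r.N) ℂ)) (hD (x, ⟨(μ, ν), hlt⟩))
      simp only [Submodule.coe_sub, Submodule.coe_add, hAapp, Submodule.coe_zero] at h
      -- `X₁ + Ad X₂ − Ad X₃ − X₄ = 0`
      have h2 : (r.ρ (U₀ (x, μ)) * ((X (x.shift μ, ν) : W) : Matrix (Fin r.N) (Fin r.N) ℂ) * r.ρ (U₀ (x, μ))⁻¹ -
            ((X (x, ν) : W) : Matrix (Fin r.N) (Fin r.N) ℂ)) -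
          (r.ρ (U₀ (x, ν)) * ((X (x.shift ν, μ) : W) : Matrix (Fin r.N) (Fin r.N) ℂ) * r.ρ (U₀ (x, ν))⁻¹ -
            ((X (x, μ) : W) : Matrix (Fin r.N) (Fin r.N) ℂ)) =
          ((X (x, μ) : W) : Matrix (Fin r.N) (Fin r.N) ℂ) +
            r.ρ (U₀ (x, μ)) * ((X (x.shift μ, ν) : W) : Matrix (Fin r.N) (Fin r.N) ℂ) * r.ρ (U₀ (x, μ))⁻¹ -
            r.ρ (U₀ (x, ν)) * ((X (x.shift ν, μ) : W) : Matrix (Fin r.N) (Fin r.N) ℂ) * r.ρ (U₀ (x, ν))⁻¹ -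
            ((X (x, ν) : W) : Matrix (Fin r.N) (Fin r.N) ℂ) := by abel
      exact sub_eq_zero.1 (h2.trans h)
    have hcoc : ∀ (x : Site d S) (μ ν : Fin d),
        r.ρ (U₀ (x, μ)) * ((X (x.shift μ, ν) : W) : Matrix (Fin r.N) (Fin r.N) ℂ) * r.ρ (U₀ (x, μ))⁻¹ -
            ((X (x, ν) : W) : Matrix (Fin r.N) (Fin r.N) ℂ) =
          r.ρ (U₀ (x, ν)) * ((X (x.shift ν, μ) : W) : Matrix (Fin r.N) (Fin r.N) ℂ) * r.ρ (U₀ (x, ν))⁻¹ -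
            ((X (x, μ) : W) : Matrix (Fin r.N) (Fin r.N) ℂ) := by
      intro x μ ν
      rcases lt_trichotomy μ ν with hlt | heq | hgt
      · exact hF x μ ν hlt
      · subst heq; rfl
      · exact (hF x ν μ hgt).symm
    obtain ⟨ξ, hξ𝔤, hξ⟩ := twistedFlat_cocycle_exact r U₀ q z hz hrig htf
      (fun μ x => ((X (x, μ) : W) : Matrix (Fin r.N) (Fin r.N) ℂ)) (fun μ x => (X (x, μ)).2) hcoc
    refine ⟨WithLp.toLp 2 (fun x => -(⟨ξ x, hξ𝔤 x⟩ : W)), PiLp.ext fun e => ?_⟩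
    have h := hξ e.1 e.2
    apply Subtype.ext
    rw [hd₀]
    simp only [map_neg, Submodule.coe_sub, Submodule.coe_neg, hAapp]
    rw [h]
    abel
  obtain ⟨K, hK, hHodge⟩ := exists_hodge_constant d₀ d₁ hdd hexact

  refine ⟨K, hK, fun X hX𝔤 => ?_⟩
  let Xv : PiLp 2 (fun _ : Edge d S => W) := WithLp.toLp 2 (fun e => (⟨X e, hX𝔤 e⟩ : W))
  have hXv : ∀ e, ((Xv e : W) : Matrix (Fin r.N) (Fin r.N) ℂ) = X e := fun e => rfl
  have hXvnorm : ‖Xv‖ ^ 2 = ∑ e, ‖X e‖ ^ 2 := by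
    rw [PiLp.norm_sq_eq_of_L2]
    exact Finset.sum_congr rfl fun e _ => by rw [← Submodule.norm_coe]
  obtain ⟨η, hηB, hηinner, hηpyth⟩ := hHodge Xv
  have hDe : ∀ e : Edge d S, ((d₀ η e : W) : Matrix (Fin r.N) (Fin r.N) ℂ) =
      ((η e.1 : W) : Matrix (Fin r.N) (Fin r.N) ℂ) -
        r.ρ (U₀ e) * ((η (e.1.shift e.2) : W) : Matrix (Fin r.N) (Fin r.N) ℂ) * r.ρ (U₀ e)⁻¹ := fun e => by
    rw [hd₀, Submodule.coe_sub, hAapp]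
  have hDp : ∀ p : Plaquette d S, ((d₁ Xv p : W) : Matrix (Fin r.N) (Fin r.N) ℂ) =
      X (p.1, p.2.1.1) + r.ρ (U₀ (p.1, p.2.1.1)) * X (p.1.shift p.2.1.1, p.2.1.2) * r.ρ (U₀ (p.1, p.2.1.1))⁻¹ -
        r.ρ (U₀ (p.1, p.2.1.2)) * X (p.1.shift p.2.1.2, p.2.1.1) * r.ρ (U₀ (p.1, p.2.1.2))⁻¹ - X (p.1, p.2.1.2) := fun p => by
    rw [hd₁]; simp only [Submodule.coe_sub, Submodule.coe_add, hAapp, hXv]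
  refine ⟨fun x => ((η x : W) : Matrix (Fin r.N) (Fin r.N) ℂ), ‖d₀ η‖, ‖Xv - d₀ η‖, fun x => (η x).2, norm_nonneg _,
    norm_nonneg _, ?_, ?_, ?_, ?_⟩
  · rw [← hXvnorm, hηpyth]
  · rw [← hηinner, PiLp.inner_apply]
    exact Finset.sum_congr rfl fun e _ => by rw [Submodule.coe_inner, hDe]; rfl
  · intro e
    rw [← hDe, Submodule.norm_coe]
    exact PiLp.norm_apply_le (d₀ η) e
  · have h1 : ‖d₁ Xv‖ ^ 2 = ∑ p : Plaquette d S,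
        ‖X (p.1, p.2.1.1) + r.ρ (U₀ (p.1, p.2.1.1)) * X (p.1.shift p.2.1.1, p.2.1.2) * r.ρ (U₀ (p.1, p.2.1.1))⁻¹ -
          r.ρ (U₀ (p.1, p.2.1.2)) * X (p.1.shift p.2.1.2, p.2.1.1) * r.ρ (U₀ (p.1, p.2.1.2))⁻¹ - X (p.1, p.2.1.2)‖ ^ 2 := by
      rw [PiLp.norm_sq_eq_of_L2]
      exact Finset.sum_congr rfl fun p _ => by rw [← Submodule.norm_coe, hDp]
    calc ‖Xv - d₀ η‖ ^ 2 ≤ (K * ‖d₁ Xv‖) ^ 2 := pow_le_pow_left₀ (norm_nonneg _) hηB 2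
      _ = _ := by rw [mul_pow, h1]

end Summit.QuantumFields.YangMills.Theorems.TwistExponentGap

end
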